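import Literature.Probability.RandomPlanarGeometry.SLEBubblesCloud
import Literature.Probability.RandomPlanarGeometry.SLEBubblesVersion
import Literature.Probability.RandomPlanarGeometry.CritPercSLE
import Literature.Probability.RandomPlanarGeometry.LoewnerTraceLimit
import Literature.Probability.RandomPlanarGeometry.LoewnerHullCapacity
import HarnessLib

/-!
# `Ξ(κ) ∈ Ω` almost surely ([LSW] Thm. 7.3 with Def. 3.1): the deterministic topology, and the reduction to the closedness statement of p. 29

Companion of `Literature.Probability.RandomPlanarGeometry.SLEBubbles` ([LSW] §7.2) for the
sample-path half of the named fact `SLEBubbles.exists_measurable_version` ("`Ξ(κ)` has a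
measurable `Ω`-valued version"), after

* G. F. Lawler, O. Schramm, W. Werner, *Conformal restriction: the chordal case*, J. Amer. Math.
  Soc. **16** (2003) 917–955, arXiv:math/0209343 (**[LSW]**, arXiv page numbers), Def. 3.1
  (p. 10: "`Ω` [is] the collection of relatively closed subsets `K` of `ℍ` such that (1) `K` is
  connected, `cl K ∩ ℝ = {0}` and `K` is unbounded; (2) `ℂ ∖ cl K` is connected"), §7.2 (p. 28:
  "Since `κ ≤ 8/3`, we know from [RS] that `γ` is a simple curve. Let
  `X̂ := {g_t⁻¹(K + W_t) : (K, t) ∈ X}` and let `Ξ` be the filling of the union of elements of `X̂`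
  and `γ`, `Ξ = F^ℝ_ℍ(γ(0, ∞) ∪ ⋃ X̂)`") and Thm. 7.3 with the end of its proof (p. 29: "all that
  remains is to show that `cl Ξ = Ξ ∪ {0}`");
* S. Rohde, O. Schramm, *Basic properties of SLE*, Ann. of Math. **161** (2005), Thm. 6.1 (the
  SLE_κ trace is a simple path for `κ ≤ 4`; the tree's named fact
  `ae_isSimpleTrace_sleTrace_of_le_four`, file `CritPercSLE`);
* G. F. Lawler, *Conformally Invariant Processes in the Plane* (2005), Prop. 4.31 (the tip of a
  chain generated by a curve is the boundary limit of `f_t = g_t⁻¹` at `W_t`; PROVED in the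
  tree, `Loewner.IsGeneratedByCurve.tendsto_invFunOn_map`, file `LoewnerTraceLimit`).

That `Ξ(κ) ∈ Ω` almost surely — what "the law of `Ξ(κ)` is `P_{α_κ}`" presupposes — is here
REDUCED (`SLEBubbles.ae_mem_restrictionConfigs_of_closure`, an `iff` given [RS]:
`SLEBubbles.ae_mem_restrictionConfigs_iff_closure`) to three almost sure statements, taken as
HYPOTHESES (no new named fact is introduced): the simple-path property of the SLE_κ trace
([RS]), the printed closedness statement `cl Ξ = Ξ ∪ {0}` of p. 29, and condition (2) of
Def. 3.1 for `Ξ` (implicit in [LSW]); everything else is PROVED, deterministically in the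
sample (`sleBubbleSet_mem_restrictionConfigs`):

* `twoSidedFilling_subset_upperHalfPlaneSet` — the filling `F^ℝ_ℍ(A)` of a set `A ⊆ ℍ` has no
  real points (a real point off `A` lies in its own component of `ℍ̄ ∖ A`); so `Ξ ⊆ ℍ` once
  `γ(0, ∞) ⊆ ℍ` (simple phase) — the attached bubbles `g_t⁻¹(K + W_t)` lie in `H_t ⊆ ℍ`;
* `isConnected_twoSidedFilling` — **the filling of a connected set `A ⊆ ℍ̄` is connected**:
  a component `C` of `ℍ̄ ∖ A` without real points satisfies `cl C ∩ A ≠ ∅` or `C ∩ cl A ≠ ∅`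
  (otherwise `C` would be closed — its closure stays in `ℍ̄ ∖ A` and is connected — and open —
  a disc about a point of `C ⊆ ℍ` off `cl A` is a connected subset of `ℍ̄ ∖ A` —, i.e. all of
  `ℂ`, yet `0 ∉ C`), so `C` hangs on `A`;
* `sleTrace_mem_closure_attachedBubble` — **each bubble `g_t⁻¹(K + W_t)` accumulates at the tip
  `γ(t)`** (`0 ∈ cl K`, so `W_t ∈ cl(K + W_t)`, and `f_t(w) → γ(t)` as `w → W_t` in `ℍ`,
  Lawler Prop. 4.31), whence `γ(0, ∞) ∪ ⋃ X̂` is connected when no bubble sits at time `0`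
  (`isConnected_sleTrace_union_attachedBubble`; a.s. the cloud has no point in `Ω_b × {0}`,
  `SLEBubbles.ae_forall_snd_ne_zero`, as `dt{0} = 0`);
* `not_isBounded_image_sleTrace` — `γ(0, ∞)` is unbounded (the hulls it generates would
  otherwise stay in a disc, against `hcap(K_t) = 2t`, `Loewner.not_isBounded_iUnion_hull`), and
  `0 = γ(0) ∈ cl γ(0, ∞)`; with `cl Ξ = Ξ ∪ {0}` and `Ξ ⊆ ℍ` this gives "relatively closed" and
  `cl Ξ ∩ ℝ = {0}`.

Hence the named fact `SLEBubbles.ae_mem_restrictionConfigs` of `SLEBubblesVersion` follows from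
[RS] and the two almost sure hypotheses for all admissible data
(`SLEBubbles.ae_mem_restrictionConfigs_of_forall_closure`), and
`SLEBubbles.exists_measurable_version` from these and the measurability leaf
`SLEBubbles.nullMeasurableSet_disjoint` (`SLEBubbles.exists_measurable_version_of_closure`).

Mathlib: `connectedComponentIn` and its API, `isPreconnected_of_forall`, `isClopen_iff`,
`mem_closure_of_tendsto`, `image_closure_subset_closure_image`,
`MeasureTheory.Measure.quasiMeasurePreserving_fst` / `_snd`.
-/

noncomputable section

open Set Filter Topology MeasureTheory Metric Bornology
open UpperHalfPlane (upperHalfPlaneSet isOpen_upperHalfPlaneSet)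
open scoped NNReal ENNReal
open Literature.Probability.Process (preWienerMeasure IsPoissonCloud)

namespace Literature.Probability.RandomPlanarGeometry

/-! ### The two-sided filling: no real points; connectedness -/

/-- **The filling of a subset of `ℍ` has no real points**: if `A ⊆ ℍ` then `F^ℝ_ℍ(A) ⊆ ℍ` (a
real point, being off `A`, lies in its own component of `ℍ̄ ∖ A`). [folklore] -/
theorem twoSidedFilling_subset_upperHalfPlaneSet {A : Set ℂ} (hA : A ⊆ upperHalfPlaneSet) :
    twoSidedFilling A ⊆ upperHalfPlaneSet := by
  intro z hz
  obtain ⟨hzim, hzcomp⟩ := mem_twoSidedFilling_iff.1 hz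
  rcases hzim.eq_or_lt with h | h
  · exfalso
    have hzA : z ∉ A := fun hzA ↦ by
      have : 0 < z.im := hA hzA
      rw [← h] at this
      exact lt_irrefl _ this
    have hzre : ((z.re : ℝ) : ℂ) = z := Complex.ext (by simp) (by simp [← h])
    refine hzcomp z.re ?_
    rw [hzre]
    exact mem_connectedComponentIn ⟨hzim, hzA⟩
  · exact h

/-- **The two-sided filling of a connected set is connected.** For a connected `A ⊆ ℍ̄`, every
component `C` of `ℍ̄ ∖ A` containing no real point (these are the components added by the
filling) satisfies `cl C ∩ A ≠ ∅` or `C ∩ cl A ≠ ∅`: otherwise `C` is closed (a closure point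
lies in `ℍ̄ ∖ A`, and `C` together with it is still connected) and open (a point of `C` lies in
`ℍ` off `cl A`, and a small disc about it is a connected subset of `ℍ̄ ∖ A`), hence all of the
connected space `ℂ`, which is absurd as `0 ∉ C`. So each such `C` is joined to `A` inside
`F^ℝ_ℍ(A) = A ∪ ⋃ C`. [folklore] -/
theorem isConnected_twoSidedFilling {A : Set ℂ} (hA : IsConnected A)
    (hAH : A ⊆ {z : ℂ | 0 ≤ z.im}) : IsConnected (twoSidedFilling A) := by
  obtain ⟨a₀, ha₀⟩ := hA.nonempty
  have hAΞ : A ⊆ twoSidedFilling A := fun z hz ↦ inter_subset_twoSidedFilling A ⟨hz, hAH hz⟩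
  refine ⟨⟨a₀, hAΞ ha₀⟩, isPreconnected_of_forall a₀ fun z hz ↦ ?_⟩
  by_cases hzA : z ∈ A
  · exact ⟨A, hAΞ, ha₀, hzA, hA.isPreconnected⟩
  -- `z` lies in a component `C` of `ℍ̄ ∖ A` containing no real point
  set Y : Set ℂ := {z : ℂ | 0 ≤ z.im} \ A with hY
  have hzY : z ∈ Y := ⟨hz.1, hzA⟩
  set C : Set ℂ := connectedComponentIn Y z with hC
  have hCY : C ⊆ Y := connectedComponentIn_subset _ _
  have hzC : z ∈ C := mem_connectedComponentIn hzY
  have hCpre : IsPreconnected C := isPreconnected_connectedComponentIn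
  have key : ∀ {x : ℝ} {w : ℂ}, w ∈ C → w ∈ connectedComponentIn Y x → False := by
    intro x w hwC hwx
    have h1 : connectedComponentIn Y z = connectedComponentIn Y w := connectedComponentIn_eq hwC
    have h2 : connectedComponentIn Y (x : ℂ) = connectedComponentIn Y w := connectedComponentIn_eq hwx
    exact (mem_twoSidedFilling_iff.1 hz).2 x (by rw [h2, ← h1]; exact hzC)
  have hCreal : ∀ x : ℝ, (x : ℂ) ∉ C := fun x hx ↦
    key hx (mem_connectedComponentIn (hCY hx))
  have hCΞ : C ⊆ twoSidedFilling A := fun w hw ↦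
    mem_twoSidedFilling_iff.2 ⟨(hCY hw).1, fun x hx ↦ key hw hx⟩
  -- either `cl C` meets `A` or `C` meets `cl A`
  have hmeet : (closure C ∩ A).Nonempty ∨ (C ∩ closure A).Nonempty := by
    by_contra hcon
    rw [not_or, not_nonempty_iff_eq_empty, not_nonempty_iff_eq_empty] at hcon
    obtain ⟨h1, h2⟩ := hcon
    -- `C` is closed
    have hCclosed : IsClosed C := by
      refine isClosed_of_closure_subset fun w hw ↦ ?_
      have hwim : 0 ≤ w.im := by
        have : closure C ⊆ {z : ℂ | 0 ≤ z.im} :=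
          closure_minimal (fun u hu ↦ (hCY hu).1) (isClosed_le continuous_const Complex.continuous_im)
        exact this hw
      have hwA : w ∉ A := fun hwA ↦ by
        have : w ∈ closure C ∩ A := ⟨hw, hwA⟩
        rw [h1] at this
        exact this
      have hwY : w ∈ Y := ⟨hwim, hwA⟩
      have hsub : insert w C ⊆ connectedComponentIn Y z :=
        (hCpre.subset_closure (subset_insert _ _) (insert_subset hw subset_closure)).subset_connectedComponentIn
          (mem_insert_of_mem _ hzC) (insert_subset hwY hCY)
      exact hsub (mem_insert _ _)
    -- `C` is open
    have hCopen : IsOpen C := by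
      refine Metric.isOpen_iff.2 fun w hw ↦ ?_
      have hwim : 0 < w.im := by
        rcases (show 0 ≤ w.im from (hCY hw).1).eq_or_lt with h | h
        · exfalso
          have : ((w.re : ℝ) : ℂ) = w := Complex.ext (by simp) (by simp [← h])
          exact hCreal w.re (this ▸ hw)
        · exact h
      have hwclA : w ∉ closure A := fun h' ↦ by
        have : w ∈ C ∩ closure A := ⟨hw, h'⟩
        rw [h2] at this
        exact this
      obtain ⟨r, hr, hball⟩ := Metric.isOpen_iff.1
        ((isClosed_closure (s := A)).isOpen_compl.inter (isOpen_lt continuous_const Complex.continuous_im))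
        w ⟨hwclA, hwim⟩
      refine ⟨r, hr, fun u hu ↦ ?_⟩
      have hballY : ball w r ⊆ Y := fun v hv ↦ by
        have hv' : 0 < v.im := (hball hv).2
        exact ⟨hv'.le, fun hvA ↦ (hball hv).1 (subset_closure hvA)⟩
      have hsub : ball w r ∪ C ⊆ connectedComponentIn Y z :=
        (IsPreconnected.union w (mem_ball_self hr) hw (convex_ball w r).isPreconnected hCpre).subset_connectedComponentIn
          (Or.inr hzC) (union_subset hballY hCY)
      exact hsub (Or.inl hu)
    -- so `C = univ`, but `0 ∉ C`
    have hCuniv : C = univ :=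
      (isClopen_iff.1 ⟨hCclosed, hCopen⟩).resolve_left (nonempty_iff_ne_empty.1 ⟨z, hzC⟩)
    refine hCreal 0 ?_
    rw [hCuniv]
    exact mem_univ _
  -- conclude: `A ∪ C` with the common closure point is a connected subset of the filling
  rcases hmeet with ⟨w, hwC, hwA⟩ | ⟨w, hwC, hwA⟩
  · refine ⟨A ∪ insert w C, union_subset hAΞ (insert_subset (hAΞ hwA) hCΞ), Or.inl ha₀,
      Or.inr (mem_insert_of_mem _ hzC), ?_⟩
    exact IsPreconnected.union w hwA (mem_insert _ _) hA.isPreconnected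
      (hCpre.subset_closure (subset_insert _ _) (insert_subset hwC subset_closure))
  · refine ⟨insert w A ∪ C, union_subset (insert_subset (hCΞ hwC) hAΞ) hCΞ,
      Or.inl (mem_insert_of_mem _ ha₀), Or.inr hzC, ?_⟩
    exact IsPreconnected.union w (mem_insert _ _) hwC
      (hA.isPreconnected.subset_closure (subset_insert _ _) (insert_subset hwA subset_closure)) hCpre

/-! ### The trace and the attached bubbles, deterministically in the sample -/

section Sample

variable {κ : ℝ≥0} {ω : ℝ≥0 → ℝ}

/-- A simple trace is a generating curve: in the junk case of `Loewner.trace` (no generating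
curve) the trace is constant, hence not injective. [folklore] -/
theorem isGeneratedByCurve_sleTrace_of_isSimpleTrace (hγ : Loewner.IsSimpleTrace (sleTrace κ ω)) :
    Loewner.IsGeneratedByCurve (sleDriving κ ω) (sleTrace κ ω) := by
  have hex : ∃ γ, Loewner.IsGeneratedByCurve (sleDriving κ ω) γ := by
    by_contra h
    have hconst : sleTrace κ ω = fun _ ↦ ((sleDriving κ ω 0 : ℝ) : ℂ) := by
      show Loewner.trace (sleDriving κ ω) = _
      rw [Loewner.trace, dif_neg h]
    have h01 : (0 : ℝ≥0) = 1 := hγ.1 (by rw [hconst])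
    exact zero_ne_one h01
  exact Loewner.isGeneratedByCurve_trace hex

/-- **Each attached bubble accumulates at the tip**: for a chain generated by the curve `γ`
(continuous driving function `W`) and a bubble `K ∈ Ω_b`, `γ(t) ∈ cl(g_t⁻¹(K + W_t))`, because
`0 ∈ cl K`, so `W_t ∈ cl(K + W_t)` with `K + W_t ⊆ ℍ`, and `g_t⁻¹(w) → γ(t)` as `w → W_t`
inside `ℍ` (Lawler (2005), Prop. 4.31, `Loewner.IsGeneratedByCurve.tendsto_invFunOn_map`).
[cite: Lawler2005, Prop. 4.31] -/
theorem sleTrace_mem_closure_attachedBubble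
    (hgen : Loewner.IsGeneratedByCurve (sleDriving κ ω) (sleTrace κ ω)) (K : BubbleConfig) (t : ℝ≥0) :
    sleTrace κ ω t ∈ closure (attachedBubble κ ω (K : Set ℂ) t) := by
  have hW := continuous_sleDriving κ ω
  set c : ℂ := (sleDriving κ ω t : ℂ) with hc
  set T : Set ℂ := (fun z ↦ z + c) '' (K : Set ℂ) with hT
  have hTH : T ⊆ upperHalfPlaneSet := by
    rintro _ ⟨z, hz, rfl⟩
    show 0 < (z + c).im
    simpa [hc] using (K.subset_upperHalfPlaneSet hz : 0 < z.im)
  -- `W_t ∈ cl (K + W_t)`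
  have hcT : c ∈ closure T := by
    have h0 : (0 : ℂ) + c ∈ (fun z ↦ z + c) '' closure (K : Set ℂ) := ⟨0, K.zero_mem_closure, rfl⟩
    rw [zero_add] at h0
    exact image_closure_subset_closure_image (continuous_id.add continuous_const) h0
  haveI : (𝓝[T] c).NeBot := mem_closure_iff_nhdsWithin_neBot.1 hcT
  have hlim : Tendsto (Loewner.loewnerInv (sleDriving κ ω) t) (𝓝[T] c) (𝓝 (sleTrace κ ω t)) :=
    (hgen.tendsto_invFunOn_map hW t).mono_left (nhdsWithin_mono _ hTH)
  exact mem_closure_of_tendsto hlim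
    (eventually_mem_nhdsWithin.mono fun z hz ↦ mem_image_of_mem _ hz)

/-- An attached bubble is connected (a continuous image of the connected bubble: translation,
then `g_t⁻¹`, continuous on `ℍ`). [folklore] -/
theorem isConnected_attachedBubble (K : BubbleConfig) (t : ℝ≥0) :
    IsConnected (attachedBubble κ ω (K : Set ℂ) t) := by
  have hW := continuous_sleDriving κ ω
  refine (K.isConnected.image _ (continuous_id.add continuous_const).continuousOn).image _ fun w hw ↦ ?_
  refine (Loewner.continuousAt_loewnerInv hW t ?_).continuousWithinAt
  obtain ⟨z, hz, rfl⟩ := hw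
  show 0 < (z + (sleDriving κ ω t : ℂ)).im
  simpa using (K.subset_upperHalfPlaneSet hz : 0 < z.im)

/-- **`γ(0, ∞) ∪ ⋃ X̂` is connected** when the trace is simple and no bubble sits at time `0`:
`γ(0, ∞)` is connected, and each bubble attached at a time `t > 0`, together with its closure
point `γ(t) ∈ γ(0, ∞)`, is a connected set meeting `γ(0, ∞)`. [folklore] -/
theorem isConnected_sleTrace_union_attachedBubble (hγ : Loewner.IsSimpleTrace (sleTrace κ ω))
    {X : Set (BubbleConfig × ℝ≥0)} (hX0 : ∀ p ∈ X, p.2 ≠ 0) :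
    IsConnected (sleTrace κ ω '' Ioi 0 ∪ ⋃ p ∈ X, attachedBubble κ ω (p.1 : Set ℂ) p.2) := by
  have hgen := isGeneratedByCurve_sleTrace_of_isSimpleTrace hγ
  have hcont : Continuous (sleTrace κ ω) := hgen.continuous
  have hG : IsConnected (sleTrace κ ω '' Ioi 0) := isConnected_Ioi.image _ hcont.continuousOn
  have h1 : sleTrace κ ω 1 ∈ sleTrace κ ω '' Ioi 0 := ⟨1, mem_Ioi.2 one_pos, rfl⟩
  refine ⟨⟨sleTrace κ ω 1, Or.inl h1⟩, isPreconnected_of_forall (sleTrace κ ω 1) ?_⟩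
  rintro y (hy | hy)
  · exact ⟨sleTrace κ ω '' Ioi 0, subset_union_left, h1, hy, hG.isPreconnected⟩
  · rw [mem_iUnion₂] at hy
    obtain ⟨p, hp, hyp⟩ := hy
    have htp : 0 < p.2 := pos_iff_ne_zero.2 (hX0 p hp)
    have hγp : sleTrace κ ω p.2 ∈ sleTrace κ ω '' Ioi 0 := ⟨p.2, htp, rfl⟩
    have hBpre : IsPreconnected (insert (sleTrace κ ω p.2) (attachedBubble κ ω (p.1 : Set ℂ) p.2)) :=
      (isConnected_attachedBubble p.1 p.2).isPreconnected.subset_closure (subset_insert _ _)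
        (insert_subset (sleTrace_mem_closure_attachedBubble hgen p.1 p.2) subset_closure)
    refine ⟨sleTrace κ ω '' Ioi 0 ∪ insert (sleTrace κ ω p.2) (attachedBubble κ ω (p.1 : Set ℂ) p.2),
      ?_, Or.inl h1, Or.inr (mem_insert_of_mem _ hyp), ?_⟩
    · refine union_subset subset_union_left (insert_subset (Or.inl hγp) ?_)
      exact fun w hw ↦ Or.inr (mem_iUnion₂.2 ⟨p, hp, hw⟩)
    · exact IsPreconnected.union (sleTrace κ ω p.2) hγp (mem_insert _ _) hG.isPreconnected hBpre

/-- **`γ(0, ∞)` is unbounded** for a chain generated by the curve `γ`: if `γ` stayed in a disc,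
so would all the hulls `K_t ⊆ Fill(γ[0, t])`, contradicting `hcap(K_t) = 2t`
(`Loewner.not_isBounded_iUnion_hull`). [folklore] -/
theorem not_isBounded_image_sleTrace
    (hgen : Loewner.IsGeneratedByCurve (sleDriving κ ω) (sleTrace κ ω)) :
    ¬ IsBounded (sleTrace κ ω '' Ioi 0) := by
  intro hb
  have hW := continuous_sleDriving κ ω
  obtain ⟨R, hR⟩ := hb.subset_closedBall 0
  set R' : ℝ := max R 0 with hR'
  have hrange : ∀ t, sleTrace κ ω t ∈ closedBall (0 : ℂ) R' := fun t ↦ by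
    rcases eq_or_ne t 0 with rfl | ht
    · rw [hgen.apply_zero, sleDriving_zero, Complex.ofReal_zero]
      exact mem_closedBall_self (le_max_right _ _)
    · exact closedBall_subset_closedBall (le_max_left _ _) (hR ⟨t, pos_iff_ne_zero.2 ht, rfl⟩)
  refine Loewner.not_isBounded_iUnion_hull hW
    ((isBounded_closedBall (x := (0 : ℂ)) (r := R')).subset (iUnion_subset fun t z hz ↦ ?_))
  rw [hgen.hull_eq t] at hz
  by_contra hzR
  refine hz.2 (diff_closedBall_subset_unboundedComponent (S := sleTrace κ ω '' Icc 0 t) ?_ ⟨hz.1, hzR⟩)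
  rintro _ ⟨s, -, rfl⟩
  exact hrange s

/-- **`Ξ(κ) ∈ Ω`, deterministically in the sample** ([LSW] Def. 3.1 for the set `Ξ(κ)` of
§7.2): if the trace `γ` of the sample `ω` is a simple path in `ℍ ∪ {0}`, no bubble of the
configuration `X` sits at time `0`, `cl Ξ = Ξ ∪ {0}` (the closedness statement of p. 29) and
`ℂ ∖ cl Ξ` is connected (Def. 3.1 (2)), then `Ξ = F^ℝ_ℍ(γ(0, ∞) ∪ ⋃ X̂)` belongs to `Ω`:
`Ξ ⊆ ℍ` (`twoSidedFilling_subset_upperHalfPlaneSet`), hence relatively closed with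
`cl Ξ ∩ ℝ = {0}` (`0 = γ(0) ∈ cl γ(0, ∞)`); connected (`isConnected_twoSidedFilling`,
`isConnected_sleTrace_union_attachedBubble`); unbounded (`not_isBounded_image_sleTrace`).
[cite: LawlerSchrammWerner2003Restriction, Def. 3.1 (p. 10) with §7.2 (p. 28) and Thm. 7.3 (p. 29)] -/
theorem sleBubbleSet_mem_restrictionConfigs (hγ : Loewner.IsSimpleTrace (sleTrace κ ω))
    {X : Set (BubbleConfig × ℝ≥0)} (hX0 : ∀ p ∈ X, p.2 ≠ 0)
    (hcl : closure (sleBubbleSet κ ω X) = sleBubbleSet κ ω X ∪ {0})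
    (hcc : IsConnected (closure (sleBubbleSet κ ω X))ᶜ) :
    sleBubbleSet κ ω X ∈ restrictionConfigs := by
  have hgen := isGeneratedByCurve_sleTrace_of_isSimpleTrace hγ
  set A : Set ℂ := sleTrace κ ω '' Ioi 0 ∪ ⋃ p ∈ X, attachedBubble κ ω (p.1 : Set ℂ) p.2 with hA
  have hAH : A ⊆ upperHalfPlaneSet := by
    rintro z (⟨t, ht, rfl⟩ | hz)
    · exact hγ.2 t ht
    · rw [mem_iUnion₂] at hz
      obtain ⟨p, -, hzp⟩ := hz
      exact attachedBubble_subset_upperHalfPlaneSet κ ω p.1.subset_upperHalfPlaneSet p.2 hzp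
  have hΞ : sleBubbleSet κ ω X = twoSidedFilling A := rfl
  have hΞH : sleBubbleSet κ ω X ⊆ upperHalfPlaneSet := twoSidedFilling_subset_upperHalfPlaneSet hAH
  have hAH' : A ⊆ {z : ℂ | 0 ≤ z.im} := fun z hz ↦ by
    have hzim : 0 < z.im := hAH hz
    exact hzim.le
  have hγΞ : sleTrace κ ω '' Ioi 0 ⊆ sleBubbleSet κ ω X := fun z hz ↦
    image_sleTrace_inter_subset_sleBubbleSet κ ω X ⟨hz, hAH' (Or.inl hz)⟩
  have h0H : (0 : ℂ) ∉ upperHalfPlaneSet := fun h ↦ by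
    have : (0 : ℝ) < (0 : ℂ).im := h
    simp at this
  refine ⟨?_, ?_, ?_, ?_, hcc⟩
  · -- relatively closed in `ℍ`
    rw [hcl, union_inter_distrib_right, singleton_inter_eq_empty.2 h0H, union_empty,
      inter_eq_left.2 hΞH]
  · -- connected
    rw [hΞ]
    exact isConnected_twoSidedFilling (isConnected_sleTrace_union_attachedBubble hγ hX0) hAH'
  · -- the closure meets `ℝ` exactly at `0`
    apply Subset.antisymm
    · rintro z ⟨hzcl, x, rfl⟩
      rw [hcl] at hzcl
      rcases hzcl with hzΞ | hz0
      · exfalso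
        have : (0 : ℝ) < ((x : ℝ) : ℂ).im := hΞH hzΞ
        simp at this
      · exact hz0
    · intro z hz
      rw [mem_singleton_iff] at hz
      subst hz
      refine ⟨closure_mono hγΞ ?_, 0, Complex.ofReal_zero⟩
      have h0 : sleTrace κ ω 0 = 0 := by
        rw [hgen.apply_zero, sleDriving_zero, Complex.ofReal_zero]
      have hsub : sleTrace κ ω '' closure (Ioi 0) ⊆ closure (sleTrace κ ω '' Ioi 0) :=
        image_closure_subset_closure_image hgen.continuous
      refine hsub ⟨0, ?_, h0⟩
      rw [closure_Ioi' ⟨1, mem_Ioi.2 one_pos⟩]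
      exact self_mem_Ici
  · -- unbounded
    exact fun hb ↦ not_isBounded_image_sleTrace hgen (hb.subset hγΞ)

end Sample

/-! ### No bubble at time `0` -/

/-- **Almost surely no bubble of the cloud sits at time `0`**: the mean measure `λ_κ μ ⊗ dt`
of the slice `Ω_b × {0}` vanishes (`dt{0} = 0`, `timeMeasure_singleton`), so the count of the
cloud there is Poisson of mean `0` (`IsPoissonCloud.measure_inter_eq_empty`). [folklore] -/
theorem SLEBubbles.ae_forall_snd_ne_zero {κ : ℝ≥0} {μ : Measure BubbleConfig}
    {Ω' : Type*} [MeasurableSpace Ω'] {P' : Measure Ω'} {X : Ω' → Set (BubbleConfig × ℝ≥0)}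
    (hX : IsPoissonCloud (bubbleCloudIntensity κ μ) X P') :
    ∀ᵐ ω' ∂P', ∀ p ∈ X ω', p.2 ≠ 0 := by
  haveI : IsProbabilityMeasure P' := hX.isProbabilityMeasure
  set s : Set (BubbleConfig × ℝ≥0) := (univ : Set BubbleConfig) ×ˢ ({0} : Set ℝ≥0) with hs
  have hsm : MeasurableSet s := MeasurableSet.univ.prod (measurableSet_singleton 0)
  have hΛ : bubbleCloudIntensity κ μ s = 0 := by
    rw [hs, bubbleCloudIntensity, Measure.smul_apply, Measure.prod_prod, timeMeasure_singleton,
      mul_zero, smul_zero]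
  have hone : P' {ω' | X ω' ∩ s = ∅} = 1 := by
    rw [hX.measure_inter_eq_empty hsm (by rw [hΛ]; exact ENNReal.zero_ne_top), hΛ]
    simp
  have hae : ∀ᵐ ω' ∂P', X ω' ∩ s = ∅ := by
    rw [ae_iff]
    exact (prob_compl_eq_zero_iff (hX.measurableSet_inter_eq_empty hsm)).2 hone
  filter_upwards [hae] with ω' h p hp hp0
  have : p ∈ X ω' ∩ s := ⟨hp, mem_univ _, hp0⟩
  rw [h] at this
  exact this

/-! ### `Ξ(κ) ∈ Ω` almost surely, given the closedness statement of p. 29 and Def. 3.1 (2) -/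

/-- **`Ξ(κ) ∈ Ω` almost surely, from the simple-path property of the trace and two almost sure
hypotheses** ([LSW] Thm. 7.3 with Def. 3.1). The hypotheses are the two properties of the
sample `Ξ(κ)` which [LSW] leave to the end of the proof of Thm. 7.3 or implicit, and which are
NOT proved in the tree:

* `hcl` — **`cl Ξ = Ξ ∪ {0}` almost surely**, the closedness statement of p. 29, verbatim:
  "Given the discussion above, all that remains is to show that `cl Ξ = Ξ ∪ {0}`" (proved
  there from (7.3) for half-discs, `P[dist(Ξ, [1, 2]) < ε] = O(ε)`, scaling, the finiteness of
  the set of bubbles of diameter `≥ ε` before `t₁`, and `⋂_{s>0} cl Ξ_s = ∅` by the stationarity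
  of SLE; it needs (7.3), `SLEBubbles.measure_disjoint`, and the strong Markov property of SLE
  with the cloud);
* `hcc` — **`ℂ ∖ cl Ξ` is connected almost surely**, condition (2) of Def. 3.1 for `Ξ(κ)`
  (implicit in the statement of Thm. 7.3, a law on `Ω`: no region of `ℍ ∖ Ξ` is pinched off
  from `ℝ ∖ {0}` at the origin by the bubbles accumulating there);

together with the simple-path property of the SLE_κ trace for `κ ≤ 4` ([RS] Thm. 6.1, the
tree's named fact `ae_isSimpleTrace_sleTrace_of_le_four`, hypothesis `hRS`). Given these, for
`0 < κ ≤ 8/3` and a Poisson cloud `X` with mean `λ_κ μ ⊗ dt` on `(Ω', P')`, almost surely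
`Ξ(κ) ∈ Ω` — by `sleBubbleSet_mem_restrictionConfigs`, no bubble sitting at time `0`
(`SLEBubbles.ae_forall_snd_ne_zero`).
[cite: LawlerSchrammWerner2003Restriction, Thm. 7.3 and end of its proof (p. 29), with Def. 3.1 (p. 10)] -/
theorem SLEBubbles.ae_mem_restrictionConfigs_of_closure
    (hRS : ∀ κ : ℝ≥0, ae_isSimpleTrace_sleTrace_of_le_four (κ := κ))
    {κ : ℝ≥0} (hκ0 : 0 < κ) (hκ : κ ≤ 8 / 3) {μ : Measure BubbleConfig}
    {Ω' : Type*} [MeasurableSpace Ω'] {P' : Measure Ω'} {X : Ω' → Set (BubbleConfig × ℝ≥0)}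
    (hX : IsPoissonCloud (bubbleCloudIntensity κ μ) X P')
    (hcl : ∀ᵐ p ∂(preWienerMeasure.prod P'),
      closure (sleBubbleSet κ p.1 (X p.2)) = sleBubbleSet κ p.1 (X p.2) ∪ {0})
    (hcc : ∀ᵐ p ∂(preWienerMeasure.prod P'), IsConnected (closure (sleBubbleSet κ p.1 (X p.2)))ᶜ) :
    ∀ᵐ p ∂(preWienerMeasure.prod P'), sleBubbleSet κ p.1 (X p.2) ∈ restrictionConfigs := by
  haveI : IsProbabilityMeasure preWienerMeasure := isProbabilityMeasure_preWienerMeasure'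
  haveI : IsProbabilityMeasure P' := hX.isProbabilityMeasure
  have h4 : κ ≤ 4 := hκ.trans (by
    rw [div_le_iff₀ (by norm_num : (0 : ℝ≥0) < 3)]
    norm_num)
  have hfst : ∀ᵐ p ∂(preWienerMeasure.prod P'), Loewner.IsSimpleTrace (sleTrace κ p.1) :=
    (Measure.quasiMeasurePreserving_fst (μ := preWienerMeasure) (ν := P')).ae (hRS κ hκ0 h4)
  have hsnd : ∀ᵐ p ∂(preWienerMeasure.prod P'), ∀ q ∈ X p.2, q.2 ≠ 0 :=
    (Measure.quasiMeasurePreserving_snd (μ := preWienerMeasure) (ν := P')).ae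
      (SLEBubbles.ae_forall_snd_ne_zero hX)
  filter_upwards [hfst, hsnd, hcl, hcc] with p h₁ h₂ h₃ h₄
  exact sleBubbleSet_mem_restrictionConfigs h₁ h₂ h₃ h₄

/-- **The two hypotheses are exactly what is missing**: given the simple-path property of the
trace, `Ξ(κ) ∈ Ω` almost surely if and only if almost surely `cl Ξ = Ξ ∪ {0}` and `ℂ ∖ cl Ξ`
is connected (`cl K = K ∪ {0}` for `K ∈ Ω`, `RestrictionConfig.closure_eq`; Def. 3.1 (2)).
[cite: LawlerSchrammWerner2003Restriction, Def. 3.1 (p. 10) with Thm. 7.3 (p. 29)] -/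
theorem SLEBubbles.ae_mem_restrictionConfigs_iff_closure
    (hRS : ∀ κ : ℝ≥0, ae_isSimpleTrace_sleTrace_of_le_four (κ := κ))
    {κ : ℝ≥0} (hκ0 : 0 < κ) (hκ : κ ≤ 8 / 3) {μ : Measure BubbleConfig}
    {Ω' : Type*} [MeasurableSpace Ω'] {P' : Measure Ω'} {X : Ω' → Set (BubbleConfig × ℝ≥0)}
    (hX : IsPoissonCloud (bubbleCloudIntensity κ μ) X P') :
    (∀ᵐ p ∂(preWienerMeasure.prod P'), sleBubbleSet κ p.1 (X p.2) ∈ restrictionConfigs) ↔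
      (∀ᵐ p ∂(preWienerMeasure.prod P'),
          closure (sleBubbleSet κ p.1 (X p.2)) = sleBubbleSet κ p.1 (X p.2) ∪ {0}) ∧
        ∀ᵐ p ∂(preWienerMeasure.prod P'), IsConnected (closure (sleBubbleSet κ p.1 (X p.2)))ᶜ := by
  constructor
  · intro h
    exact ⟨h.mono fun p hp ↦ RestrictionConfig.closure_eq ⟨_, hp⟩, h.mono fun p hp ↦ hp.2.2.2.2⟩
  · rintro ⟨hcl, hcc⟩
    exact SLEBubbles.ae_mem_restrictionConfigs_of_closure hRS hκ0 hκ hX hcl hcc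

/-- **The sample-path leaf `SLEBubbles.ae_mem_restrictionConfigs` of `SLEBubblesVersion`, from
the simple-path property of the trace ([RS]) and the two almost sure hypotheses for every
admissible `(κ, μ, X)`**: the closedness `cl Ξ = Ξ ∪ {0}` of p. 29 (`hcl`) and Def. 3.1 (2)
for `Ξ` (`hcc`), stated with the quantifier prefix of the leaf.
[cite: LawlerSchrammWerner2003Restriction, Thm. 7.3 (p. 29) with Def. 3.1 (p. 10)] -/
theorem SLEBubbles.ae_mem_restrictionConfigs_of_forall_closure
    (hRS : ∀ κ : ℝ≥0, ae_isSimpleTrace_sleTrace_of_le_four (κ := κ))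
    (hcl : ∀ {κ : ℝ≥0}, 0 < κ → κ ≤ 8 / 3 → ∀ {μ : Measure BubbleConfig}, IsBrownianBubbleMeasure μ →
      ∀ {Ω' : Type} [MeasurableSpace Ω'] {P' : Measure Ω'} {X : Ω' → Set (BubbleConfig × ℝ≥0)},
        IsPoissonCloud (bubbleCloudIntensity κ μ) X P' →
          ∀ᵐ p ∂(preWienerMeasure.prod P'),
            closure (sleBubbleSet κ p.1 (X p.2)) = sleBubbleSet κ p.1 (X p.2) ∪ {0})
    (hcc : ∀ {κ : ℝ≥0}, 0 < κ → κ ≤ 8 / 3 → ∀ {μ : Measure BubbleConfig}, IsBrownianBubbleMeasure μ →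
      ∀ {Ω' : Type} [MeasurableSpace Ω'] {P' : Measure Ω'} {X : Ω' → Set (BubbleConfig × ℝ≥0)},
        IsPoissonCloud (bubbleCloudIntensity κ μ) X P' →
          ∀ᵐ p ∂(preWienerMeasure.prod P'), IsConnected (closure (sleBubbleSet κ p.1 (X p.2)))ᶜ) :
    SLEBubbles.ae_mem_restrictionConfigs := by
  intro κ hκ0 hκ μ hμ Ω' _ P' X hX
  exact SLEBubbles.ae_mem_restrictionConfigs_of_closure hRS hκ0 hκ hX (hcl hκ0 hκ hμ hX)
    (hcc hκ0 hκ hμ hX)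

/-- **`Ξ(κ)` has a measurable `Ω`-valued version, from the simple-path property of the trace,
the two almost sure hypotheses and the measurability leaf**: the named fact
`SLEBubbles.exists_measurable_version` ([LSW] Thm. 7.3: `Ξ(κ)` is a random element of `Ω`)
follows from [RS] (`hRS`), the closedness `cl Ξ = Ξ ∪ {0}` of p. 29 (`hcl`), Def. 3.1 (2) for
`Ξ` (`hcc`) and the null-measurability of the avoidance sets
(`SLEBubbles.nullMeasurableSet_disjoint`), by `SLEBubbles.exists_measurable_version_of_leaves`.
[cite: LawlerSchrammWerner2003Restriction, Thm. 7.3 (p. 29) with Def. 3.1 (p. 10) and §3 p. 10] -/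
theorem SLEBubbles.exists_measurable_version_of_closure
    (hRS : ∀ κ : ℝ≥0, ae_isSimpleTrace_sleTrace_of_le_four (κ := κ))
    (hcl : ∀ {κ : ℝ≥0}, 0 < κ → κ ≤ 8 / 3 → ∀ {μ : Measure BubbleConfig}, IsBrownianBubbleMeasure μ →
      ∀ {Ω' : Type} [MeasurableSpace Ω'] {P' : Measure Ω'} {X : Ω' → Set (BubbleConfig × ℝ≥0)},
        IsPoissonCloud (bubbleCloudIntensity κ μ) X P' →
          ∀ᵐ p ∂(preWienerMeasure.prod P'),
            closure (sleBubbleSet κ p.1 (X p.2)) = sleBubbleSet κ p.1 (X p.2) ∪ {0})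
    (hcc : ∀ {κ : ℝ≥0}, 0 < κ → κ ≤ 8 / 3 → ∀ {μ : Measure BubbleConfig}, IsBrownianBubbleMeasure μ →
      ∀ {Ω' : Type} [MeasurableSpace Ω'] {P' : Measure Ω'} {X : Ω' → Set (BubbleConfig × ℝ≥0)},
        IsPoissonCloud (bubbleCloudIntensity κ μ) X P' →
          ∀ᵐ p ∂(preWienerMeasure.prod P'), IsConnected (closure (sleBubbleSet κ p.1 (X p.2)))ᶜ)
    (hmeas : SLEBubbles.nullMeasurableSet_disjoint) : SLEBubbles.exists_measurable_version :=
  SLEBubbles.exists_measurable_version_of_leaves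
    (SLEBubbles.ae_mem_restrictionConfigs_of_forall_closure hRS hcl hcc) hmeas

end Literature.Probability.RandomPlanarGeometry

end
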